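import Mathlib
import Summits.MatrixMultiplication.MatrixMultiplication.Theses.HiddenToeplitzCorners
import Literature.Computability.AlgebraicComplexity.SchoenhageTauBini
import Literature.Computability.AlgebraicComplexity.FlatteningBound

/-!
# `HiddenToeplitzCorners.LiftGlue` (stmt-MatrixMultiplication-7499) — proved

The glue support of route `MatrixMultiplication/HiddenToeplitzCorners`:
`LiftGlue : AndrewsLifting → CheapIdealMembers → MatrixMultiplication`, i.e. Andrews' lifting
theorem (every nonzero `f ∈ ℂ[X_ij : i,j < r]` divisible by `det X` of division-free complexity
`s` gives `bR(⟨⌊r/4⌋,⌊r/4⌋,⌊r/4⌋⟩) ≤ 6s`) together with cheap ideal members (for every `ε > 0`,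
for infinitely many `r`, such an `f` with `s ≤ r^(2+ε)`) yields `ω(ℂ) = 2`.

Proof (elementary real analysis over two PROVED tree facts — Bini's theorem
`Literature.Computability.AlgebraicComplexity.Blaser2013_thm66_holds` (Bläser 2013, Thm. 6.6,
cubic form `bR(⟨q,q,q⟩) ≤ t, q ≥ 2, t ≥ 1 ⇒ ω ≤ log_q t`) and the flattening bound
`Literature.Computability.AlgebraicComplexity.omega_two_le` (`2 ≤ ω`)):
fix `δ > 0` and put `ε := δ/2`. Along the frequent set of `CheapIdealMembers ε` pick `r` so large
that `r ≥ 8` and `6 · 8^(2+δ) ≤ r^(δ/2)` (an `atTop`-eventual condition, `r^(δ/2) → ∞`), with its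
witness `f`. With `q := ⌊r/4⌋ ≥ 2` and `r ≤ 8q`, Andrews lifting gives
`bR(⟨q,q,q⟩) ≤ 6·complexity f ≤ t := max 1 (6·complexity f)`, and
`t ≤ 6 r^(2+δ/2) = 6 r^(2+δ) r^(-δ/2) ≤ 6 · 8^(2+δ) q^(2+δ) r^(-δ/2) ≤ q^(2+δ)`;
Bini gives `ω(ℂ) ≤ log_q t ≤ 2 + δ`. Hence `ω(ℂ) ≤ 2`, and `ω(ℂ) ≥ 2` is `omega_two_le`.
No statement of the route is restated; the theorem's type is literally the route decl.
-/

namespace Summit.MatrixMultiplication.MatrixMultiplication.Theorems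

open Filter
open Literature.Computability.AlgebraicComplexity

/-- **Analytic core of `LiftGlue`.** Under `AndrewsLifting` and `CheapIdealMembers` (route
`HiddenToeplitzCorners`), `ω(ℂ) ≤ 2`: for every `δ > 0`, a cheap ideal member at exponent
`2 + δ/2` and a large enough `r` (so that `6 · 8^(2+δ) ≤ r^(δ/2)`) gives, with `q = ⌊r/4⌋`,
`bR(⟨q,q,q⟩) ≤ q^(2+δ)`, whence `ω(ℂ) ≤ 2 + δ` by Bini's theorem (Bläser 2013, Thm. 6.6,
`Blaser2013_thm66_holds`). [cite: Blaser2013, Thm. 6.6] -/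
theorem omega_le_two_of_andrewsLifting_of_cheapIdealMembers
    (hA : Summit.MatrixMultiplication.MatrixMultiplication.Theses.HiddenToeplitzCorners.AndrewsLifting)
    (hC : Summit.MatrixMultiplication.MatrixMultiplication.Theses.HiddenToeplitzCorners.CheapIdealMembers) :
    omega ℂ ≤ 2 := by
  unfold Summit.MatrixMultiplication.MatrixMultiplication.Theses.HiddenToeplitzCorners.AndrewsLifting
    at hA
  unfold Summit.MatrixMultiplication.MatrixMultiplication.Theses.HiddenToeplitzCorners.CheapIdealMembers
    at hC
  refine le_of_forall_pos_le_add fun δ hδ => ?_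
  have hε : (0 : ℝ) < δ / 2 := by positivity
  -- eventually in `r`: `r ≥ 8` and the constant `6 · 8^(2+δ)` is absorbed by `r^(δ/2)`
  have hev : ∀ᶠ r : ℕ in atTop, 8 ≤ r ∧ (6 : ℝ) * (8 : ℝ) ^ (2 + δ) ≤ (r : ℝ) ^ (δ / 2) := by
    refine (eventually_ge_atTop 8).and ?_
    have ht : Tendsto (fun r : ℕ => (r : ℝ) ^ (δ / 2)) atTop atTop :=
      (tendsto_rpow_atTop hε).comp tendsto_natCast_atTop_atTop
    exact ht.eventually_ge_atTop _
  obtain ⟨r, ⟨f, hf0, hdvd, hcost⟩, hr8, hconst⟩ := ((hC (δ / 2) hε).and_eventually hev).exists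
  -- `q := r / 4 ≥ 2`, `r ≤ 8 q`
  have hq2 : 2 ≤ r / 4 := by omega
  have hrq : r ≤ 8 * (r / 4) := by omega
  have hq0 : (0 : ℝ) < (r / 4 : ℕ) := by exact_mod_cast (by omega : 0 < r / 4)
  have hq1 : (1 : ℝ) < (r / 4 : ℕ) := by exact_mod_cast (by omega : 1 < r / 4)
  have hr0 : (0 : ℝ) < r := by exact_mod_cast (by omega : 0 < r)
  have hrq' : (r : ℝ) ≤ 8 * ((r / 4 : ℕ) : ℝ) := by exact_mod_cast hrq
  -- Andrews lifting: `bR(⟨q,q,q⟩) ≤ 6 · complexity f ≤ t := max 1 (6 · complexity f)`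
  have hbr := hA r f hf0 hdvd
  have ht1 : 1 ≤ max 1 (6 * complexity f) := le_max_left _ _
  have hbr' : algBorderRank (matMulTensor ℂ (r / 4) (r / 4) (r / 4)) ≤ max 1 (6 * complexity f) :=
    hbr.trans (le_max_right _ _)
  -- Bini (Bläser 2013, Thm. 6.6, cubic form): `ω(ℂ) ≤ log_q t`
  have hbini : omega ℂ ≤ Real.logb ((r / 4 : ℕ) : ℝ) ((max 1 (6 * complexity f) : ℕ) : ℝ) :=
    Blaser2013_thm66.cubic Blaser2013_thm66_holds ℂ hq2 ht1 hbr'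
  -- the key estimate `6 r^(2+δ/2) ≤ q^(2+δ)`
  have hkey : (6 : ℝ) * (r : ℝ) ^ (2 + δ / 2) ≤ ((r / 4 : ℕ) : ℝ) ^ (2 + δ) := by
    have hmul : (6 : ℝ) * (r : ℝ) ^ (2 + δ / 2) * (r : ℝ) ^ (δ / 2) ≤
        ((r / 4 : ℕ) : ℝ) ^ (2 + δ) * (r : ℝ) ^ (δ / 2) := by
      have hexp : 2 + δ / 2 + δ / 2 = 2 + δ := by ring
      calc (6 : ℝ) * (r : ℝ) ^ (2 + δ / 2) * (r : ℝ) ^ (δ / 2)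
          = 6 * (r : ℝ) ^ (2 + δ) := by rw [mul_assoc, ← Real.rpow_add hr0, hexp]
        _ ≤ 6 * (8 * ((r / 4 : ℕ) : ℝ)) ^ (2 + δ) := by gcongr
        _ = 6 * (8 : ℝ) ^ (2 + δ) * ((r / 4 : ℕ) : ℝ) ^ (2 + δ) := by
            rw [Real.mul_rpow (by norm_num) hq0.le]; ring
        _ ≤ (r : ℝ) ^ (δ / 2) * ((r / 4 : ℕ) : ℝ) ^ (2 + δ) := by gcongr
        _ = ((r / 4 : ℕ) : ℝ) ^ (2 + δ) * (r : ℝ) ^ (δ / 2) := mul_comm _ _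
    exact le_of_mul_le_mul_right hmul (Real.rpow_pos_of_pos hr0 _)
  -- hence `t ≤ q^(2+δ)`
  have htle : ((max 1 (6 * complexity f) : ℕ) : ℝ) ≤ ((r / 4 : ℕ) : ℝ) ^ (2 + δ) := by
    have h1 : (1 : ℝ) ≤ ((r / 4 : ℕ) : ℝ) ^ (2 + δ) := Real.one_le_rpow hq1.le (by positivity)
    have h2 : (6 : ℝ) * (complexity f : ℝ) ≤ ((r / 4 : ℕ) : ℝ) ^ (2 + δ) :=
      le_trans (by gcongr) hkey
    push_cast
    exact max_le h1 h2
  have ht0 : (0 : ℝ) < ((max 1 (6 * complexity f) : ℕ) : ℝ) := by exact_mod_cast ht1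
  calc omega ℂ ≤ Real.logb ((r / 4 : ℕ) : ℝ) ((max 1 (6 * complexity f) : ℕ) : ℝ) := hbini
    _ ≤ Real.logb ((r / 4 : ℕ) : ℝ) (((r / 4 : ℕ) : ℝ) ^ (2 + δ)) :=
        Real.logb_le_logb_of_le hq1 ht0 htle
    _ = 2 + δ := Real.logb_rpow hq0 hq1.ne'

/-- **Item `stmt-MatrixMultiplication-7499` (`LiftGlue`), exact signature
`AndrewsLifting → CheapIdealMembers → MatrixMultiplication`.** Andrews' lifting theorem and cheap
nonzero members of the determinantal ideal `(det X_r)` for infinitely many `r` give `ω(ℂ) = 2`: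
the upper bound is `omega_le_two_of_andrewsLifting_of_cheapIdealMembers` (Bini's theorem,
Bläser 2013, Thm. 6.6, `Blaser2013_thm66_holds`), the lower bound is the flattening bound
`omega_two_le` (Bläser 2013, §5), and `MatrixMultiplication` is literally `omega ℂ = 2`
(`MatrixMultiplication_iff`). [cite: Blaser2013, Thm. 6.6] -/
theorem liftGlue_proof :
    Summit.MatrixMultiplication.MatrixMultiplication.Theses.HiddenToeplitzCorners.LiftGlue := by
  unfold Summit.MatrixMultiplication.MatrixMultiplication.Theses.HiddenToeplitzCorners.LiftGlue
  intro hA hC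
  show omega ℂ = 2
  exact le_antisymm (omega_le_two_of_andrewsLifting_of_cheapIdealMembers hA hC) (omega_two_le ℂ)

end Summit.MatrixMultiplication.MatrixMultiplication.Theorems
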